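import Literature.Analysis.FluidPDE.GKPCriticalElements
import HarnessLib

/-!
# Gallagher–Koch–Planchon 2016, Thm. 1 and Albritton 2018, Thm. 1.1 — the critical Besov norm
# blows up at a finite maximal time — in their FAITHFUL form over GKP's solution class

Topic `Analysis/FluidPDE`. Sources: I. Gallagher, G. Koch, F. Planchon, *Blow-up of critical Besov
norms at a potential Navier–Stokes singularity*, Comm. Math. Phys. 343 (2016) 39–82 =
arXiv:1407.4156 [`GKP2016`], Thm. 1 (p. 5 of the arXiv version, held text
`paper:arxiv-1407.4156`); D. Albritton, *Blow-up criteria for the Navier–Stokes equations in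
non-endpoint critical Besov spaces*, Anal. PDE 11 (2018) 1415–1456 = arXiv:1612.04439
[`Albritton2018`], Thm. 1.1 (p. 4 of the arXiv version, held text `paper:arxiv-1612.04439`).

These are the two named facts WANTED since the verdict clean-up of 2026-08-15
(`CriticalRegularity.lean`, §"Verdict clean-up": the tree-class renderings `gkp_besov_blowup`,
`albritton_besov_blowup` are deprecated as mis-stated over `IsMaximalBesovMildSolution`; the
faithful statements read over Gallagher–Koch–Planchon's own class `IsMaximalGKPSolution p q T ν u U`
of `GKPCriticalElements.lean` — `NS(u₀)` in the path space `𝓛^{1:∞}_{p,q}[T' < T*]`, maximal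
there). The statements below are, verbatim, the hypotheses `hG` of
`hasSmoothExtensionPast_of_eHomBesovNorm_bounded_of_gkp_besov_blowup_pathSpace` and `hA` of
`hasSmoothExtensionPast_of_eHomBesovNorm_bounded_of_albritton_besov_blowup_pathSpace`
(`NSCriticalClosureBesovGKPClass.lean`), so that those theorems consume `(h : <fact>)` directly.

## The printed statements

* **GKP 2016, Theorem 1.** "Let `p, q ∈ (3,∞)` be given, and consider a divergence free vector
  field `u₀` in `Ḃ^{s_p}_{p,q}`. Let `u = NS(u₀) ∈ 𝓛^{1:∞}_{p,q}[T < T*]` be the unique strong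
  Navier–Stokes solution of (1.2) with maximal time of existence `T*`. If `T* < ∞`, then
  `limsup_{t→T*} ‖u(t)‖_{Ḃ^{s_p}_{p,q}} = ∞`."
* **Albritton 2018, Theorem 1.1** (Blow-up criterion). "Let `3 < p,q < ∞` and
  `u₀ ∈ Ḃ^{s_p}_{p,q}(ℝ³)` be a divergence-free vector field. Suppose `u` is the mild solution of
  the Navier–Stokes equations on `ℝ³ × [0,T*)` with initial data `u₀` and maximal time of existence
  `T*(u₀)`. If `T* < ∞`, then `lim_{t↑T*} ‖u(·,t)‖_{Ḃ^{s_p}_{p,q}(ℝ³)} = ∞`."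

## Contents (named facts, D-0014)

* `gkp_besov_blowup_pathSpace` — GKP 2016, Thm. 1 (`limsup` form).
* `albritton_besov_blowup_pathSpace` — Albritton 2018, Thm. 1.1 (limit form).

## Transcription notes

* *Class.* `IsMaximalGKPSolution p q T ν u U` (`GKPCriticalElements.lean`): `(u, U)` is a Besov mild
  solution of the critical class `(s_p, p, q)`, `s_p = −1 + 3/p`, on `[0,T)` with viscosity `ν`
  (`U t` the tempered-distribution slice, `u t` its function representative), lying in GKP's path
  space on every `[0,T']`, `T' < T`, and admitting no extension in that class beyond `T` — i.e.
  `u = NS(u₀)` and `T = T* < ∞`; this is the reading fixed by the tree on 2026-08-15 (module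
  docstrings of `CriticalRegularity.lean`, `GKPCriticalElements.lean`,
  `NSCriticalClosureBesovGKPClass.lean`). Albritton's mild solution of his Thm. 4.2 is unique in
  `C([0,T]; Ḃ^{s_p}_{p,q}) ∩ L̃¹_T Ḃ^{s_p+2}_{p,q} ∩ L̃^∞_T Ḃ^{s_p}_{p,q}`, GKP's path space, so
  both theorems concern the same object.
* *Norm.* `‖U t‖_{Ḃ^{s_p}_{p,q}} = FunctionSpaces.eHomBesovNorm (−1 + 3/p) p q (U t)` (in `ℝ≥0∞`);
  `limsup_{t→T*} = ∞` as `Filter.limsup … (𝓝[<] T) = ∞`, `lim = ∞` as `Tendsto … (𝓝[<] T) (𝓝 ∞)`.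
* *Viscosity.* Printed for `ν = 1`; general `ν > 0` through `w(y,s) = ν⁻¹u(y,s/ν)` (a unit-viscosity
  solution of the same class with data `ν⁻¹u₀`, lifespan `νT*`, and `‖w(s)‖_{Ḃ} = ν⁻¹‖u(s/ν)‖_{Ḃ}`),
  exactly as in the deprecated renderings and in the consuming theorems.
* Not here: the proofs (profile decompositions / critical elements — `gkp_exists_criticalElement`
  and its `_pathSpace` reading belong to `GKPCriticalElements.lean`), Albritton's Thm. 1.2–1.4.

## Mathlib / tree search

`lean search 'besov_blowup_pathSpace|IsMaximalGKPSolution'` (2026-08-26): the class and the two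
consuming theorems exist; the facts themselves were only WANTED (docstrings of
`CriticalRegularity.lean` ll. 555, 592), not declared. No Mathlib content.

## References

* I. Gallagher, G. Koch, F. Planchon, Comm. Math. Phys. 343 (2016) = arXiv:1407.4156, Thm. 1
  (p. 5), (1.2)–(1.3), (1.7). [`GKP2016`]
* D. Albritton, Anal. PDE 11 (2018) = arXiv:1612.04439, Thm. 1.1 (p. 4), Thm. 4.2. [`Albritton2018`]
-/

noncomputable section

open MeasureTheory Set Filter
open _root_.Topology
open scoped SchwartzMap ENNReal NNReal

namespace Literature.Analysis.FluidPDE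

/-- **Gallagher–Koch–Planchon 2016, Theorem 1 (faithful form over GKP's class).** For every
viscosity `ν > 0`, all `3 < p, q < ∞` and `0 < T`: every maximal GKP solution `(u, U)` of the
critical class `(s_p, p, q)` with lifespan `T` — `u = NS(u₀)`, the unique mild solution in the path
space `𝓛^{1:∞}_{p,q}[T' < T*]`, with `T* = T < ∞` — satisfies
`limsup_{t→T⁻} ‖U t‖_{Ḃ^{-1+3/p}_{p,q}} = ∞`. Printed (`ν = 1`): "Let `p, q ∈ (3,∞)` …, `u₀`
divergence free in `Ḃ^{s_p}_{p,q}`, `u = NS(u₀) ∈ 𝓛^{1:∞}_{p,q}[T < T*]` the unique strong solution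
with maximal time of existence `T*`. If `T* < ∞`, then `limsup_{t→T*} ‖u(t)‖_{Ḃ^{s_p}_{p,q}} = ∞`."
This is the wanted fact `gkp_besov_blowup_pathSpace` of `CriticalRegularity.lean` (verbatim the
hypothesis `hG` of `hasSmoothExtensionPast_of_eHomBesovNorm_bounded_of_gkp_besov_blowup_pathSpace`);
it replaces the deprecated `gkp_besov_blowup`. [cite: GKP2016, Thm. 1 (arXiv:1407.4156 p. 5)] -/
def gkp_besov_blowup_pathSpace : Prop :=
  ∀ ⦃ν : ℝ⦄, 0 < ν → ∀ ⦃p q : ℝ≥0∞⦄ [Fact (1 ≤ p)], 3 < p → p < ∞ → 3 < q → q < ∞ →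
    ∀ ⦃T : ℝ⦄, 0 < T → ∀ ⦃u : ℝ → EuclideanSpace ℝ (Fin 3) → EuclideanSpace ℝ (Fin 3)⦄
      ⦃U : ℝ → 𝓢'(EuclideanSpace ℝ (Fin 3), EuclideanSpace ℂ (Fin 3))⦄,
      IsMaximalGKPSolution p q T ν u U →
        limsup (fun t => FunctionSpaces.eHomBesovNorm (-1 + 3 / p.toReal) p q (U t))
          (𝓝[<] T) = ∞

/-- **Albritton 2018, Theorem 1.1 (faithful form over GKP's class).** For every viscosity `ν > 0`,
all `3 < p, q < ∞` and `0 < T`: every maximal GKP solution `(u, U)` of the critical class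
`(s_p, p, q)` with lifespan `T` satisfies `‖U t‖_{Ḃ^{-1+3/p}_{p,q}} → ∞` as `t → T⁻` (a genuine
limit). Printed (`ν = 1`): "Let `3 < p,q < ∞` and `u₀ ∈ Ḃ^{s_p}_{p,q}(ℝ³)` be a divergence-free
vector field. Suppose `u` is the mild solution … on `ℝ³ × [0,T*)` with initial data `u₀` and
maximal time of existence `T*(u₀)`. If `T* < ∞`, then `lim_{t↑T*} ‖u(·,t)‖_{Ḃ^{s_p}_{p,q}} = ∞`."
This is the wanted fact `albritton_besov_blowup_pathSpace` of `CriticalRegularity.lean` (verbatim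
the hypothesis `hA` of
`hasSmoothExtensionPast_of_eHomBesovNorm_bounded_of_albritton_besov_blowup_pathSpace`); it replaces
the deprecated `albritton_besov_blowup`. [cite: Albritton2018, Thm. 1.1 (arXiv:1612.04439 p. 4)] -/
def albritton_besov_blowup_pathSpace : Prop :=
  ∀ ⦃ν : ℝ⦄, 0 < ν → ∀ ⦃p q : ℝ≥0∞⦄ [Fact (1 ≤ p)], 3 < p → p < ∞ → 3 < q → q < ∞ →
    ∀ ⦃T : ℝ⦄, 0 < T → ∀ ⦃u : ℝ → EuclideanSpace ℝ (Fin 3) → EuclideanSpace ℝ (Fin 3)⦄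
      ⦃U : ℝ → 𝓢'(EuclideanSpace ℝ (Fin 3), EuclideanSpace ℂ (Fin 3))⦄,
      IsMaximalGKPSolution p q T ν u U →
        Tendsto (fun t => FunctionSpaces.eHomBesovNorm (-1 + 3 / p.toReal) p q (U t))
          (𝓝[<] T) (𝓝 ∞)

end Literature.Analysis.FluidPDE

end
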